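import Literature.NumberTheory.EllipticCurves.BSDSelmerPConverseYanZhuProofs
import Literature.NumberTheory.EllipticCurves.LeadingTermProofs
import Literature.NumberTheory.EllipticCurves.BSDSelmerCMPConverseRankOneProofs
import HarnessLib

/-!
# The auxiliary Heegner field of a sign `-1` elliptic curve: descent data (Selmer corank, rank, analytic rank unchanged)

Pure proofs, no new definitions and no new named facts (D-0014/D-0026). For an elliptic curve
`E/ℚ` with global root number `w(E) = -1` and any prime `p`, the standard opening move of every
`p`-converse theorem run over an AUXILIARY imaginary quadratic field (Skinner 2014/2020 §1,
Burungale–Skinner–Tian–Wan arXiv:2409.01350 proof of Thm. 12.3, Yan–Zhu 2024 §4.6, Kim 2022 §1,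
Burungale–Tian 2020 §4.2; inlined six times in `BSDSelmerPConverseYanZhuProofs`,
`BSDSelmerCMPConverseHeegnerFieldProofs`, `BSDSelmerCMPConverseKLevelProofs`) is isolated here
ONCE as a reusable theorem:

* `exists_heegnerField_descent_of_rootNumber_eq_neg_one` — from the Modularity Theorem (`hmod`,
  `ModularForms.exists_isNewformOf`), Hoffstein–Luo 1997 / Waldspurger (`hHL`,
  `HoffsteinLuo1997_exists_twist_L_one_ne_zero`) and Kato's finiteness theorem (`hKato`,
  `kato_finite_of_L_one_ne_zero`, for the twist at every prime), there is an imaginary quadratic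
  `K` of arbitrarily large discriminant with: the Heegner hypothesis for the FULL conductor
  `N_E = W.conductorNorm ℤ`, `p` split in `K`, `d_K ≡ 1 (mod 8)`, `L(E^{(d_K)}, 1) ≠ 0`, and
  consequently, by the tree's quadratic base-change additivity theorems
  (`selmerCorank_baseChange_quadratic_holds`, `mordellWeilRank_baseChange_quadratic_holds`,
  `analyticRankEK_eq_add_of`) with the twist's contributions all `0` (Kato: `E^{(d_K)}(ℚ)` and
  `Sel_{q^∞}(E^{(d_K)}/ℚ)` finite; `ord_{s=1} L(E^{(d_K)}, s) = 0`):
  `corank Sel_{q^∞}(E/K) = corank Sel_{q^∞}(E/ℚ)` for every prime `q`, `rank E(K) = rank E(ℚ)` and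
  `ord_{s=1} L(E/K, s) = ord_{s=1} L(E, s)`.
* `exists_heegnerField_descent_of_selmerCorank_eq_one` — the same with the sign read off
  `corank_{ℤ_p} Sel_{p^∞}(E/ℚ) = 1` by the `p`-parity theorem (`hpar`, `p_parity`,
  Dokchitser–Dokchitser 2010 Thm. 1.4), recording also `corank Sel_{p^∞}(E/K) = 1`.
* `exists_heegnerField_descent_of_mordellWeilRank_eq_one_of_finite_sha` — the same from
  `rank E(ℚ) = 1 ∧ #Ш(E/ℚ)[p^∞] < ∞` (Greenberg's corank identity,
  `selmerCorank_eq_one_of_mordellWeilRank_eq_one_of_finite`), recording `rank E(K) = 1` and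
  `corank Sel_{p^∞}(E/K) = 1`.

These are the binder-carrying forms of the "descent field" / "Heegner field data" steps of the
rung routes `CongruentShaFreeCut` (S2) and `MordellShaFreeCut` (S2b) of `BirchSwinnertonDyer`
(cell `bsd-cn100`), where they are specialised to `E_n` at `p = 2` and `E_D` at `p = 3`; every
hypothesis is a REFEREED named fact of the tree. Nothing here is specific to CM or to the prime.

References: [HoffsteinLuo1997] Theorem (§1); [Kato2004Asterisque] Cor. 14.3; [BCDTJAMS2001] Thm. A;
[DokchitserDokchitserAnnals2010] Thm. 1.4; [Greenberg1999LNM] §1; [YanZhu2024MainConjNonCM] §4.6.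
-/

noncomputable section

open scoped Classical

open WeierstrassCurve

namespace Literature.NumberTheory.EllipticCurves

/-- **Descent data of an auxiliary Heegner field for a sign `-1` curve.** For `E/ℚ` elliptic with
`w(E) = -1`, a prime `p` and a bound `B`: granted modularity (`hmod`), Hoffstein–Luo (`hHL`) and
Kato's finiteness theorem (`hKato`), there is an imaginary quadratic field `K` with `|d_K| > B`,
every prime of the conductor `N_E` split in `K` (Heegner hypothesis for `W.conductorNorm ℤ`), `p`
split in `K`, `d_K ≡ 1 (mod 8)`, `L(E^{(d_K)}, 1) ≠ 0`, and over which the `q^∞`-Selmer corank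
(every prime `q`), the Mordell–Weil rank and the analytic rank of `E` are those over `ℚ`
(`corank Sel_{q^∞}(E/K) = corank Sel_{q^∞}(E/ℚ) + corank Sel_{q^∞}(E^{(d_K)}/ℚ)` etc., the twist
terms vanishing by Kato). Yan–Zhu 2024, §4.6 (proof of Thm. 4.15, (2) ⇒ (3)), with
Hoffstein–Luo in place of Friedberg–Hoffstein.
[cite: YanZhu2024MainConjNonCM, Thm. 4.15 (proof, §4.6)] [cite: HoffsteinLuo1997, Theorem (§1, pp. 435–436)]
[cite: Kato2004Asterisque, Cor. 14.3 (p. 235)] -/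
theorem exists_heegnerField_descent_of_rootNumber_eq_neg_one
    (hmod : ModularForms.exists_isNewformOf) (hHL : HoffsteinLuo1997_exists_twist_L_one_ne_zero)
    (hKato : ∀ (W : WeierstrassCurve ℚ) [W.IsElliptic] (p : ℕ) [Fact p.Prime],
      kato_finite_of_L_one_ne_zero W p)
    (W : WeierstrassCurve ℚ) [W.IsElliptic] (hw : W.rootNumber = -1) {p : ℕ} (hp : p.Prime)
    (B : ℕ) :
    ∃ (K : Type) (_ : Field K) (_ : NumberField K),
      IsImaginaryQuadratic K ∧ B < (NumberField.discr K).natAbs ∧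
        SatisfiesHeegnerHypothesis (W.conductorNorm ℤ) K ∧ SatisfiesHeegnerHypothesis p K ∧
          NumberField.discr K % 8 = 1 ∧
            (W.quadraticTwist (NumberField.discr K : ℚ)).entireLFunction 1 ≠ 0 ∧
              (∀ (q : ℕ) [Fact q.Prime], (W.baseChange K).selmerCorank q = W.selmerCorank q) ∧
                (W.baseChange K).mordellWeilRank = W.mordellWeilRank ∧
                  analyticRankEK W K = W.analyticRank := by
  -- (b) the auxiliary imaginary quadratic field, from Hoffstein–Luo, with `d_K ≡ 1 (mod 8)`
  obtain ⟨K, _, _, hK, hB, hHN, hHp, hd8, hL1⟩ :=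
    exists_heegnerField_split_twist_ne_zero_discr_emod_eight_of_hoffsteinLuo hmod hHL W hw hp B
  refine ⟨K, inferInstance, inferInstance, hK, hB, hHN, hHp, hd8, hL1, ?_, ?_, ?_⟩
  · -- (c)+(d) Kato: the `q^∞`-Selmer group of the twist is finite, hence of corank `0`
    intro q _
    have hd : (NumberField.discr K : ℚ) ≠ 0 := by exact_mod_cast NumberField.discr_ne_zero K
    haveI := W.isElliptic_quadraticTwist hd
    obtain ⟨-, -, hfin⟩ := hKato (W.quadraticTwist (NumberField.discr K : ℚ)) q hL1
    haveI := hfin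
    have h0 : (W.quadraticTwist (NumberField.discr K : ℚ)).selmerCorank q = 0 :=
      (W.quadraticTwist (NumberField.discr K : ℚ)).selmerCorank_eq_zero_of_finite q
    rw [selmerCorank_baseChange_quadratic_holds W K hK.1 q, h0, add_zero]
  · -- Kato: the twist has finitely many rational points, hence rank `0`
    have hd : (NumberField.discr K : ℚ) ≠ 0 := by exact_mod_cast NumberField.discr_ne_zero K
    haveI := W.isElliptic_quadraticTwist hd
    haveI : Fact p.Prime := ⟨hp⟩
    obtain ⟨hfinpt, -, -⟩ := hKato (W.quadraticTwist (NumberField.discr K : ℚ)) p hL1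
    rw [mordellWeilRank_baseChange_quadratic_holds W K hK.1,
      mordellWeilRank_eq_zero_of_finite _ hfinpt, add_zero]
  · -- (f) Artin factorisation of the analytic rank over `K`, the twist term being `0`
    rw [analyticRankEK_eq_add_of (hasEntireLFunction_rat_of_exists_isNewformOf hmod) W K,
      analyticRank_eq_zero_of_entireLFunction_one_ne_zero _ hL1, add_zero]

/-- **Descent data from Selmer corank one.** For `E/ℚ` elliptic, a prime `p` with
`corank_{ℤ_p} Sel_{p^∞}(E/ℚ) = 1`: the `p`-parity theorem (`hpar`, Dokchitser–Dokchitser 2010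
Thm. 1.4: `(-1)^{corank} = w(E)`) gives `w(E) = -1`, and
`exists_heegnerField_descent_of_rootNumber_eq_neg_one` supplies an imaginary quadratic `K` with
the Heegner hypothesis for `N_E`, `p` split, `d_K ≡ 1 (mod 8)`, `L(E^{(d_K)}, 1) ≠ 0`,
`corank_{ℤ_p} Sel_{p^∞}(E/K) = 1`, `rank E(K) = rank E(ℚ)` and `ord_{s=1} L(E/K, s) = ord_{s=1} L(E, s)`.
[cite: DokchitserDokchitserAnnals2010, Thm. 1.4] [cite: YanZhu2024MainConjNonCM, Thm. 4.15 (proof, §4.6)] -/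
theorem exists_heegnerField_descent_of_selmerCorank_eq_one
    (hpar : ∀ (W : WeierstrassCurve ℚ) [W.IsElliptic] (p : ℕ) [Fact p.Prime], p_parity W p)
    (hmod : ModularForms.exists_isNewformOf) (hHL : HoffsteinLuo1997_exists_twist_L_one_ne_zero)
    (hKato : ∀ (W : WeierstrassCurve ℚ) [W.IsElliptic] (p : ℕ) [Fact p.Prime],
      kato_finite_of_L_one_ne_zero W p)
    (W : WeierstrassCurve ℚ) [W.IsElliptic] (p : ℕ) [Fact p.Prime]
    (hcorank : W.selmerCorank p = 1) (B : ℕ) :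
    ∃ (K : Type) (_ : Field K) (_ : NumberField K),
      IsImaginaryQuadratic K ∧ B < (NumberField.discr K).natAbs ∧
        SatisfiesHeegnerHypothesis (W.conductorNorm ℤ) K ∧ SatisfiesHeegnerHypothesis p K ∧
          NumberField.discr K % 8 = 1 ∧
            (W.quadraticTwist (NumberField.discr K : ℚ)).entireLFunction 1 ≠ 0 ∧
              (W.baseChange K).selmerCorank p = 1 ∧
                (W.baseChange K).mordellWeilRank = W.mordellWeilRank ∧
                  analyticRankEK W K = W.analyticRank := by
  -- (a) parity: the root number is `-1`
  have hw : W.rootNumber = -1 := by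
    have h := hpar W p
    unfold p_parity at h
    rw [hcorank, pow_one] at h
    exact h.symm
  obtain ⟨K, _, _, hK, hB, hHN, hHp, hd8, hL1, hcor, hrk, han⟩ :=
    exists_heegnerField_descent_of_rootNumber_eq_neg_one hmod hHL hKato W hw
      (Fact.out : p.Prime) B
  exact ⟨K, inferInstance, inferInstance, hK, hB, hHN, hHp, hd8, hL1, by rw [hcor p, hcorank],
    hrk, han⟩

/-- **Descent data from rank one and `#Ш[p^∞] < ∞`.** For `E/ℚ` elliptic, a prime `p` with
`rank E(ℚ) = 1` and `Ш(E/ℚ)[p^∞]` finite: Greenberg's corank identity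
(`selmerCorank_eq_one_of_mordellWeilRank_eq_one_of_finite`) gives `corank_{ℤ_p} Sel_{p^∞}(E/ℚ) = 1`,
and `exists_heegnerField_descent_of_selmerCorank_eq_one` supplies an imaginary quadratic `K` with
the Heegner hypothesis for `N_E`, `p` split, `d_K ≡ 1 (mod 8)`, `L(E^{(d_K)}, 1) ≠ 0`,
`corank_{ℤ_p} Sel_{p^∞}(E/K) = 1`, `rank E(K) = 1` and `ord_{s=1} L(E/K, s) = ord_{s=1} L(E, s)`
— the hypothesis side of the `Ш`-finite `p`-converse moved to `K` (Kim 2022, §1, diagram (1.1)).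
[cite: Greenberg1999LNM, §1 pp. 54–57] [cite: Kim2022, §1 (before Cor. 1.4)]
[cite: DokchitserDokchitserAnnals2010, Thm. 1.4] -/
theorem exists_heegnerField_descent_of_mordellWeilRank_eq_one_of_finite_sha
    (hpar : ∀ (W : WeierstrassCurve ℚ) [W.IsElliptic] (p : ℕ) [Fact p.Prime], p_parity W p)
    (hmod : ModularForms.exists_isNewformOf) (hHL : HoffsteinLuo1997_exists_twist_L_one_ne_zero)
    (hKato : ∀ (W : WeierstrassCurve ℚ) [W.IsElliptic] (p : ℕ) [Fact p.Prime],
      kato_finite_of_L_one_ne_zero W p)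
    (W : WeierstrassCurve ℚ) [W.IsElliptic] (p : ℕ) [Fact p.Prime]
    (hrank : W.mordellWeilRank = 1) (hsha : Finite (AddCommGroup.primaryComponent W.sha p))
    (B : ℕ) :
    ∃ (K : Type) (_ : Field K) (_ : NumberField K),
      IsImaginaryQuadratic K ∧ B < (NumberField.discr K).natAbs ∧
        SatisfiesHeegnerHypothesis (W.conductorNorm ℤ) K ∧ SatisfiesHeegnerHypothesis p K ∧
          NumberField.discr K % 8 = 1 ∧
            (W.quadraticTwist (NumberField.discr K : ℚ)).entireLFunction 1 ≠ 0 ∧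
              (W.baseChange K).selmerCorank p = 1 ∧
                (W.baseChange K).mordellWeilRank = 1 ∧
                  analyticRankEK W K = W.analyticRank := by
  have hcorank : W.selmerCorank p = 1 :=
    selmerCorank_eq_one_of_mordellWeilRank_eq_one_of_finite W p hrank hsha
  obtain ⟨K, _, _, hK, hB, hHN, hHp, hd8, hL1, hcor, hrk, han⟩ :=
    exists_heegnerField_descent_of_selmerCorank_eq_one hpar hmod hHL hKato W p hcorank B
  exact ⟨K, inferInstance, inferInstance, hK, hB, hHN, hHp, hd8, hL1, hcor, by rw [hrk, hrank],
    han⟩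

end Literature.NumberTheory.EllipticCurves
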